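import Summits.Ventures.PercRepro.AntipodalSMC
import Summits.Ventures.PercRepro.LemmaBPointed

/-!
# Lemma B for maps avoiding the non-crossing cells (the `M₃`-valued case), any `d`

The C-005 kernel `crossKernel cross4` fails the SMC second-difference condition on exactly the
24 cover pairs `(x_i ⋖ ⊤) × (R ⋖ x_j)`, `R` a non-crossing two-block cell below `x_j`
(`proofs/P6-antipodal-smc.md` §3): every failure involves one of the ten non-crossing proper cells of
`Part(4)`. On the sub-poset `{⊥, x_1, x_2, x_3, ⊤}` (the lattice `M₃`, the image of the maps in p4's
exhaustive `d = 5` census of 275,665,902 monotone maps) the condition holds on all comparable pairs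
— the same 49-case table as for `Part(3)`. Hence, by the antipodal SMC principle
(`sum_kernel_compl_nonneg` on the subtype of admissible cells), Lemma B holds for every monotone map
whose values lie in `{⊥, ⊤} ∪ range x`, for any crossing family `x` whose cells are proper, and for
every `d`:

* `LemmaBFamily_of_image_subset` — the generic statement (any `k`, any crossing family `x` with
  `x i ≠ ⊥, ⊤`);
* **`LemmaB_of_M3_valued`** — the `k = 4` instance: a monotone `c : Config S → Setoid (Fin 4)` with
  `c σ ∈ {⊥, ⊤, ab|cd, ac|bd, ad|bc}` for all `σ` satisfies `crossCount cross4 c ≤ topBotCount c`.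

So a counterexample to Lemma B (k = 4), if any, must use a non-crossing proper cell: the gap is
exactly the interaction `(R ⋖ x_j)` with `(x_i ⋖ ⊤)`.
-/

namespace PercRepro

open Finset

/-! ### The kernel of a crossing family on the cells `⊥`, `x_i`, `⊤` -/

section FamilyKernel

variable {k r : ℕ} {x : Fin r → Setoid (Fin k)}

open Classical in
/-- The family kernel vanishes on the diagonal (the cells of the family are distinct, `⊥ ≠ ⊤`). -/
theorem crossKernel_self (hx : Function.Injective x) (hne : (⊥ : Setoid (Fin k)) ≠ ⊤)
    (s : Setoid (Fin k)) : crossKernel x s s = 0 := by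
  unfold crossKernel
  have h1 : ∀ i j : Fin r, (if i ≠ j ∧ s = x i ∧ s = x j then (1 : ℝ) else 0) = 0 := by
    intro i j
    rw [if_neg]
    rintro ⟨hij, h1, h2⟩
    exact hij (hx (h1.symm.trans h2))
  rw [if_neg (fun h => hne (h.2.symm.trans h.1)), if_neg (fun h => hne (h.1.symm.trans h.2)),
    Finset.sum_eq_zero (fun i _ => Finset.sum_eq_zero (fun j _ => h1 i j))]
  norm_num

open Classical in
/-- Cross kernel of a pointed family: the pair `(⊤, ⊥)` has kernel value `1`. -/
theorem crossKernel_top_bot (hbot : ∀ i, x i ≠ ⊥) (hne : (⊥ : Setoid (Fin k)) ≠ ⊤) :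
    crossKernel x ⊤ ⊥ = 1 := by
  unfold crossKernel
  have h1 : ∀ i j : Fin r, (if i ≠ j ∧ (⊥ : Setoid (Fin k)) = x i ∧ (⊤ : Setoid (Fin k)) = x j
      then (1 : ℝ) else 0) = 0 := by
    intro i j
    rw [if_neg]
    rintro ⟨-, h, -⟩
    exact hbot i h.symm
  rw [if_pos ⟨rfl, rfl⟩, if_neg (fun h => hne h.1.symm),
    Finset.sum_eq_zero (fun i _ => Finset.sum_eq_zero (fun j _ => h1 i j))]
  norm_num

open Classical in
/-- Cross kernel of a pointed family: the pair `(⊥, ⊤)` has kernel value `1`. -/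
theorem crossKernel_bot_top (hbot : ∀ i, x i ≠ ⊥) (hne : (⊥ : Setoid (Fin k)) ≠ ⊤) :
    crossKernel x ⊥ ⊤ = 1 := by
  unfold crossKernel
  have h1 : ∀ i j : Fin r, (if i ≠ j ∧ (⊤ : Setoid (Fin k)) = x i ∧ (⊥ : Setoid (Fin k)) = x j
      then (1 : ℝ) else 0) = 0 := by
    intro i j
    rw [if_neg]
    rintro ⟨-, -, h⟩
    exact hbot j h.symm
  rw [if_neg (fun h => hne h.1), if_pos ⟨rfl, rfl⟩,
    Finset.sum_eq_zero (fun i _ => Finset.sum_eq_zero (fun j _ => h1 i j))]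
  norm_num

open Classical in
/-- Cross kernel of a pointed family: `(⊤, x j)` has kernel value `0`. -/
theorem crossKernel_top_cell (hbot : ∀ i, x i ≠ ⊥) (htop : ∀ i, x i ≠ ⊤) (j : Fin r) :
    crossKernel x ⊤ (x j) = 0 := by
  unfold crossKernel
  have h1 : ∀ i i' : Fin r, (if i ≠ i' ∧ x j = x i ∧ (⊤ : Setoid (Fin k)) = x i'
      then (1 : ℝ) else 0) = 0 := by
    intro i i'
    rw [if_neg]
    rintro ⟨-, -, h⟩
    exact htop i' h.symm
  rw [if_neg (fun h => hbot j h.2), if_neg (fun h => htop j h.2),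
    Finset.sum_eq_zero (fun i _ => Finset.sum_eq_zero (fun i' _ => h1 i i'))]
  norm_num

open Classical in
/-- Cross kernel of a pointed family: `(x i, ⊤)` has kernel value `0`. -/
theorem crossKernel_cell_top (hbot : ∀ i, x i ≠ ⊥) (htop : ∀ i, x i ≠ ⊤) (i : Fin r) :
    crossKernel x (x i) ⊤ = 0 := by
  unfold crossKernel
  have h1 : ∀ i' j : Fin r, (if i' ≠ j ∧ (⊤ : Setoid (Fin k)) = x i' ∧ x i = x j
      then (1 : ℝ) else 0) = 0 := by
    intro i' j
    rw [if_neg]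
    rintro ⟨-, h, -⟩
    exact htop i' h.symm
  rw [if_neg (fun h => htop i h.1), if_neg (fun h => hbot i h.1),
    Finset.sum_eq_zero (fun i' _ => Finset.sum_eq_zero (fun j _ => h1 i' j))]
  norm_num

open Classical in
/-- Cross kernel of a pointed family: `(⊥, x j)` has kernel value `0`. -/
theorem crossKernel_bot_cell (hbot : ∀ i, x i ≠ ⊥) (htop : ∀ i, x i ≠ ⊤)
    (hne : (⊥ : Setoid (Fin k)) ≠ ⊤) (j : Fin r) : crossKernel x ⊥ (x j) = 0 := by
  unfold crossKernel
  have h1 : ∀ i i' : Fin r, (if i ≠ i' ∧ x j = x i ∧ (⊥ : Setoid (Fin k)) = x i'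
      then (1 : ℝ) else 0) = 0 := by
    intro i i'
    rw [if_neg]
    rintro ⟨-, -, h⟩
    exact hbot i' h.symm
  rw [if_neg (fun h => hne h.1), if_neg (fun h => htop j h.2),
    Finset.sum_eq_zero (fun i _ => Finset.sum_eq_zero (fun i' _ => h1 i i'))]
  norm_num

open Classical in
/-- Cross kernel of a pointed family: `(x i, ⊥)` has kernel value `0`. -/
theorem crossKernel_cell_bot (hbot : ∀ i, x i ≠ ⊥) (htop : ∀ i, x i ≠ ⊤) (i : Fin r) :
    crossKernel x (x i) ⊥ = 0 := by
  unfold crossKernel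
  have h1 : ∀ i' j : Fin r, (if i' ≠ j ∧ (⊥ : Setoid (Fin k)) = x i' ∧ x i = x j
      then (1 : ℝ) else 0) = 0 := by
    intro i' j
    rw [if_neg]
    rintro ⟨-, h, -⟩
    exact hbot i' h.symm
  rw [if_neg (fun h => htop i h.1), if_neg (fun h => hbot i h.1),
    Finset.sum_eq_zero (fun i' _ => Finset.sum_eq_zero (fun j _ => h1 i' j))]
  norm_num

open Classical in
/-- The family kernel at two cells of the family: `-1` when distinct, `0` when equal. -/
theorem crossKernel_cell_cell (hx : Function.Injective x) (hbot : ∀ i, x i ≠ ⊥)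
    (htop : ∀ i, x i ≠ ⊤) (i j : Fin r) :
    crossKernel x (x i) (x j) = if i = j then 0 else -1 := by
  unfold crossKernel
  have h1 : ∀ i' j' : Fin r, (if i' ≠ j' ∧ x j = x i' ∧ x i = x j' then (1 : ℝ) else 0) =
      if i' = j ∧ j' = i ∧ i ≠ j then 1 else 0 := by
    intro i' j'
    by_cases e1 : i' = j <;> by_cases e2 : j' = i
    · rw [e1, e2]
      by_cases hij : i = j
      · simp [hij]
      · simp [hij, Ne.symm hij]
    · have : x i ≠ x j' := fun h => e2 (hx h).symm
      simp [e1, e2, this]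
    · have : x j ≠ x i' := fun h => e1 (hx h).symm
      simp [e1, e2, this]
    · have : x j ≠ x i' := fun h => e1 (hx h).symm
      simp [e1, e2, this]
  simp only [h1, htop i, hbot i, false_and, if_false, zero_add, zero_sub]
  by_cases hij : i = j
  · subst hij
    simp
  · rw [if_neg hij, Finset.sum_eq_single j]
    · rw [Finset.sum_eq_single i]
      · simp [hij]
      · intro b _ hb
        simp [hb]
      · simp
    · intro b _ hb
      refine Finset.sum_eq_zero fun b' _ => ?_
      simp [hb]
    · simp

end FamilyKernel

/-! ### The sub-poset `{⊥, x_i, ⊤}` and the second-difference condition on it -/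

section M3

variable {k r : ℕ} (x : Fin r → Setoid (Fin k))

/-- The admissible cells: `⊥`, `⊤`, or a cell of the family. -/
def IsFamilyCell (s : Setoid (Fin k)) : Prop := s = ⊥ ∨ s = ⊤ ∨ ∃ i, s = x i

variable {x}

/-- A cell of a crossing family with proper cells is below another one only if they are equal. -/
theorem IsCrossingFamily.le_iff (hx : IsCrossingFamily x) (hbot : ∀ i, x i ≠ ⊥) {i j : Fin r} :
    x i ≤ x j ↔ i = j := by
  constructor
  · intro h
    by_contra hij
    have hinf : x i ⊓ x j = ⊥ := hx.inf_eq_bot hij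
    rw [inf_eq_left.2 h] at hinf
    exact hbot i hinf
  · rintro rfl
    exact le_rfl

/-- A strict comparison between admissible cells starts at `⊥` or ends at `⊤`. -/
theorem IsFamilyCell.lt_cases (hx : IsCrossingFamily x) (hbot : ∀ i, x i ≠ ⊥)
    (htop : ∀ i, x i ≠ ⊤) (hne : (⊥ : Setoid (Fin k)) ≠ ⊤) {a b : Setoid (Fin k)}
    (ha : IsFamilyCell x a) (hb : IsFamilyCell x b) (h : a < b) :
    (a = ⊥ ∧ ∃ i, b = x i) ∨ (a = ⊥ ∧ b = ⊤) ∨ (∃ i, a = x i ∧ b = ⊤) := by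
  rcases ha with rfl | rfl | ⟨i, rfl⟩ <;> rcases hb with rfl | rfl | ⟨j, rfl⟩
  · exact absurd h (lt_irrefl _)
  · exact Or.inr (Or.inl ⟨rfl, rfl⟩)
  · exact Or.inl ⟨rfl, j, rfl⟩
  · exact absurd (top_le_iff.1 h.le) hne
  · exact absurd h (lt_irrefl _)
  · exact absurd (top_le_iff.1 h.le) (htop j)
  · exact absurd (le_bot_iff.1 h.le) (hbot i)
  · exact Or.inr (Or.inr ⟨i, rfl, rfl⟩)
  · exact absurd ((hx.le_iff hbot).1 h.le) (fun hij => h.ne (by rw [hij]))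

/-- **The family kernel is SMC on the admissible cells**: nonpositive second differences on all
comparable pairs of `{⊥, x_i, ⊤}`. -/
theorem crossKernel_second_difference_of_isFamilyCell (hx : IsCrossingFamily x)
    (hbot : ∀ i, x i ≠ ⊥) (htop : ∀ i, x i ≠ ⊤) (hne : (⊥ : Setoid (Fin k)) ≠ ⊤)
    {a b a' b' : Setoid (Fin k)} (ha : IsFamilyCell x a) (hb : IsFamilyCell x b)
    (ha' : IsFamilyCell x a') (hb' : IsFamilyCell x b') (hab : a ≤ b) (hab' : a' ≤ b') :
    crossKernel x b b' - crossKernel x b a' - crossKernel x a b' + crossKernel x a a' ≤ 0 := by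
  rcases eq_or_lt_of_le hab with rfl | hab
  · linarith
  rcases eq_or_lt_of_le hab' with rfl | hab'
  · linarith
  rcases IsFamilyCell.lt_cases hx hbot htop hne ha hb hab with ⟨rfl, i, rfl⟩ | ⟨rfl, rfl⟩ |
      ⟨i, rfl, rfl⟩ <;>
    rcases IsFamilyCell.lt_cases hx hbot htop hne ha' hb' hab' with ⟨rfl, j, rfl⟩ | ⟨rfl, rfl⟩ |
      ⟨j, rfl, rfl⟩ <;>
    simp only [crossKernel_top_bot hbot hne, crossKernel_bot_top hbot hne,
      crossKernel_top_cell hbot htop, crossKernel_cell_top hbot htop, crossKernel_bot_cell hbot htop hne,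
      crossKernel_cell_bot hbot htop, crossKernel_cell_cell hx.injective hbot htop,
      crossKernel_self hx.injective hne] <;>
    (try split_ifs) <;> norm_num

/-- **Lemma B for maps with admissible values** (any crossing family with proper cells, any `d`):
if every value of the monotone map `c` is `⊥`, `⊤` or a cell of the family, then the antipodal pairs
carrying two distinct cells of the family are at most the `{⊤, ⊥}` antipodal pairs. -/
theorem LemmaBFamily_of_image_subset (hx : IsCrossingFamily x) (hbot : ∀ i, x i ≠ ⊥)
    (htop : ∀ i, x i ≠ ⊤) (hne : (⊥ : Setoid (Fin k)) ≠ ⊤) {S : Type} [Fintype S] [DecidableEq S]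
    (c : Config S → Setoid (Fin k)) (hc : Monotone c) (hM : ∀ σ, IsFamilyCell x (c σ)) :
    crossCount x c ≤ topBotCount c := by
  -- the map into the subtype of admissible cells
  let c' : Config S → {s : Setoid (Fin k) // IsFamilyCell x s} := fun σ => ⟨c σ, hM σ⟩
  have hc' : Monotone c' := fun σ τ h => Subtype.mk_le_mk.2 (hc h)
  have h := sum_kernel_compl_nonneg hc' (fun a b => crossKernel x a.1 b.1)
    (fun a => le_of_eq (crossKernel_self hx.injective hne a.1).symm)
    (fun a b a' b' hab hab' => crossKernel_second_difference_of_isFamilyCell hx hbot htop hne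
      a.2 b.2 a'.2 b'.2 hab hab')
  change 0 ≤ ∑ σ : Config S, crossKernel x (c σ) (c σᶜ) at h
  rw [sum_crossKernel_compl hx.injective] at h
  have h' : (crossCount x c : ℝ) ≤ topBotCount c := by linarith
  exact_mod_cast h'

end M3

/-! ### The `k = 4` instance: the three crossing partitions -/

/-- `cross4 i` is not the one-block partition. -/
theorem cross4_ne_top (i : Fin 3) : cross4 i ≠ ⊤ := by
  intro h
  have h1 : cross4 i 0 1 := by rw [h]; trivial
  have h2 : cross4 i 0 2 := by rw [h]; trivial
  rw [cross4_rel] at h1 h2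
  fin_cases i <;> simp at h1 h2

/-- The discrete and the one-block partition of four indices differ. -/
theorem Setoid.bot_ne_top_fin4 : (⊥ : Setoid (Fin 4)) ≠ ⊤ := by
  intro h
  have h1 : (⊤ : Setoid (Fin 4)) 0 1 := trivial
  rw [← h] at h1
  exact absurd (show (0 : Fin 4) = 1 from h1) (by decide)

/-- **Lemma B (k = 4) for `M₃`-valued maps, every `d`**: a monotone map into the partitions of four
indices all of whose values are `⊥`, `⊤` or a crossing partition satisfies Lemma B. This is the
class of p4's exhaustive `d = 5` census (275,665,902 maps), now for all `d`; a counterexample to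
`LemmaBAbstract` must take a non-crossing proper value. -/
theorem LemmaB_of_M3_valued {S : Type} [Fintype S] [DecidableEq S]
    (c : Config S → Setoid (Fin 4)) (hc : Monotone c)
    (hM : ∀ σ, c σ = ⊥ ∨ c σ = ⊤ ∨ ∃ i, c σ = cross4 i) :
    crossCount cross4 c ≤ topBotCount c :=
  LemmaBFamily_of_image_subset cross4_isCrossingFamily cross4_ne_bot cross4_ne_top
    Setoid.bot_ne_top_fin4 c hc hM

/-- The `k = 3` theorem `LemmaB3Abstract_holds` is the instance of the generic statement in which the
classification `Setoid.fin3_cases` supplies the admissibility of every value. -/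
theorem LemmaB3Abstract_holds' : LemmaB3Abstract := fun c hc =>
  LemmaBFamily_of_image_subset cross3_isCrossingFamily cross3_ne_bot cross3_ne_top
    Setoid.bot_ne_top_fin3 c hc (fun σ => Setoid.fin3_cases (c σ))

end PercRepro
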